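import Literature.Computability.AlgebraicComplexity.RealTauConjectureDepthFour
import Literature.Computability.AlgebraicComplexity.TavenasHutchinsonFamily
import HarnessLib

/-!
# The Koiran–Tavenas transfer theorem via Tavenas' `P`-definable family `V_n` (no counting hierarchy)

The named fact `Literature.Computability.AlgebraicComplexity.not_isPBounded_constantFreeComplexity_perPoly_of_realTauConjecture`
(`TauConjecture.lean`; Tavenas 2014, Thm. 3.3: the real τ-conjecture implies that `τ(PER_n)` is
not polynomially bounded) is proved in the thesis (p. 47) with the Pochhammer–Wilkinson
polynomials `PW_n = ∏_{i ≤ 2^n} (X - i)`, whose definability in `P/poly` under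
`τ(PER) = n^{O(1)}` needs the counting hierarchy (Lemma 3.9 = Bürgisser's `#P`-completeness /
`CH`-collapse lemmas; Lemma 3.16 = iterated products in `CH`). Section 2.2 of the same chapter
("Avec la définissabilité dans `P`", pp. 53–54) points out that the family
`V_n = ∑_{i<2^n} 2^{2·2^n·i - 2i(i+1)} X^i` (Lemme 3.36, the tree's `tavenasV`,
`TavenasHutchinsonFamily.lean`) has exponentially many distinct real roots AND coefficient bits
decidable in `P`, so that "la définissabilité dans `P` permet d'éviter de dépendre du lemme 3.9":
Prop. 3.17 applies to `(V_n)` directly (Cor. 3.37), and the proof of Thm. 3.3 goes through with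
`V_n` in place of `PW_n`.

This file carries out that variant of the printed proof of Thm. 3.3:

* `exists_sps_of_isProjection_perPoly`: the conclusion of Prop. 3.21 (sum of `n^{O(√d)}` products
  of `O(√d)` many `n^{O(√d)}`-sparse polynomials) for ANY family `(f_n)` given together with the
  data that Prop. 3.17 produces — a multilinear `h_n ∈ ℚ[x_0..x_{d-1}, z_0..z_{r-1}]`,
  `r ≤ d = n^{O(1)}`, that is a projection of `PER_{q(n)}`, `q` p-bounded, with
  `f_n = h_n(X^{2^j}; 2^{2^i})` — under `τ(PER_n) = n^{O(1)}`. The proof is, verbatim, the tree's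
  proof of `Tavenas2014_prop_3_21_of_prop_3_17` (`RealTauConjectureDepthFour.lean`: projections
  are free, constant-free circuits are circuits over `ℚ`, the proved depth-four reduction
  `DepthReduction.SLP.exists_sum_prod`, sparsity under monomial substitutions), with the single
  invocation of Prop. 3.17 replaced by the hypothesis.
* `Tavenas2014_cor_3_37` (named fact, D-0014): Tavenas' Cor. 3.37 — Prop. 3.17 for the family
  `(V_n)` — in the rendering of the tree's `Tavenas2014_prop_3_17` (the multilinear `h_n` is a
  projection of `PER_{q(n)}` over `ℚ`, `q` p-bounded, `V_n = h_n(X^{2^j}; 2^{2^i})`), with the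
  ambient variable blocks `d = r = 2n + 3` (print: `d = n`, `r = 2n + 1`; see the docstring).
  It is discharged in `TavenasVnWitness.lean` from BCS Thm. (21.29) alone (the coefficient-bit
  circuit of `V_n` is written down, so neither `VNP ⊆ VNP_e` nor any Boolean complexity class is
  needed).
* `not_isPBounded_constantFreeComplexity_perPoly_of_realTauConjecture_of_cor_3_37`: PROVED —
  Cor. 3.37 implies the target fact: by `exists_sps_of_isProjection_perPoly`, `V_n` is a sum of
  `k ≤ n^{O(√n)}` products of `m = O(√n)` polynomials with `t ≤ n^{O(√n)}` monomials over
  `ℚ ⊂ ℝ`; the real τ-conjecture bounds its `2^n - 1` distinct real roots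
  (`le_card_roots_toFinset_map_tavenasV`) by `(k + m + t + 2)^c = 2^{O(√n log n)}`, absurd for
  `n = 4^j` large (`exists_pow_sqrt_lt_two_pow`).

Consequently the trust base of the Koiran–Tavenas transfer theorem shrinks from
{Bürgisser Cor. 3.9, Bürgisser Lemma 2.12, BCS (21.26), BCS (21.29)}
(`RealTauConjectureFinal.lean`) to {BCS (21.29)} (`TavenasVnWitness.lean`).

## References

* S. Tavenas, *Bornes inférieures et supérieures dans les circuits arithmétiques*, PhD thesis,
  ENS Lyon 2014, Thm. 3.3 and its proof (p. 47), Prop. 3.17, Prop. 3.21, §2.2 "Avec la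
  définissabilité dans `P`" (pp. 53–54): Lemme 3.36, Cor. 3.37, Thm. 3.38.
* P. Koiran, *Shallow circuits with high-powered inputs*, ICS 2011, §6.
-/

noncomputable section

open MvPolynomial

namespace Literature.Computability.AlgebraicComplexity

open ArithCircuit Complexity

/-! ### Prop. 3.21's conclusion from Prop. 3.17's data -/

open Polynomial in
/-- **The conclusion of Tavenas' Prop. 3.21 for a family given with the data of Prop. 3.17**
(thesis p. 47, proof of Prop. 3.21: "D'après la proposition 3.17 … D'après le théorème 2.16 …"):
if `τ(PER_n) = n^{O(1)}` and, for every `n`, `f_n = h_n(X^{2^j}; 2^{2^i})` for a multilinear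
`h_n ∈ ℚ[x_0, …, x_{d-1}, z_0, …, z_{r-1}]` (`r ≤ d = n^{O(1)}`) which is a projection of
`PER_{q(n)}` with `q` p-bounded, then `f_n = ∑_{i ≤ k} ∏_{j ≤ m} g_{ij}` over `ℚ` with
`k ≤ (n+2)^{C(⌊√d⌋+1)}`, `m ≤ C(⌊√d⌋+1)` and every `g_{ij}` having at most `(n+2)^{C(⌊√d⌋+1)}`
monomials. The proof is that of `Tavenas2014_prop_3_21_of_prop_3_17`, verbatim after its first
line. [cite: Tavenas2014, Prop. 3.21] -/
theorem exists_sps_of_isProjection_perPoly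
    (hτ : IsPBounded fun n => constantFreeComplexity (perPoly (Fin n) ℤ))
    (f : ℕ → Polynomial ℤ) (d r : ℕ → ℕ) (hd : IsPBounded d) (hrd : ∀ n, r n ≤ d n)
    (q : ℕ → ℕ) (hq : IsPBounded q)
    (H : ∀ n, ∃ h : MvPolynomial (Fin (d n) ⊕ Fin (r n)) ℚ,
      IsProjection h (perPoly (Fin (q n)) ℚ) ∧ (∀ m ∈ h.support, ∀ x, m x ≤ 1) ∧
        MvPolynomial.aeval (kpSubst (d n) (r n)) h = (f n).map (Int.castRingHom ℚ)) :
    ∃ C : ℕ, ∀ n, ∃ (k m t : ℕ) (g : Fin k → Fin m → Polynomial ℚ),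
      k ≤ (n + 2) ^ (C * (Nat.sqrt (d n) + 1)) ∧
      m ≤ C * (Nat.sqrt (d n) + 1) ∧
      t ≤ (n + 2) ^ (C * (Nat.sqrt (d n) + 1)) ∧
      (∀ i j, (g i j).support.card ≤ t) ∧
      (∑ i, ∏ j, g i j) = (f n).map (Int.castRingHom ℚ) := by
  classical
  -- polynomial bounds as powers of `B = n + 2`
  obtain ⟨e₁, he₁⟩ := hd.exists_le_pow
  obtain ⟨e₂, he₂⟩ := (IsPBounded.comp_holds hτ hq).exists_le_pow
  refine ⟨prop321Const (e₁ + e₂ + 6), fun n => ?_⟩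
  obtain ⟨h, hproj, hml, hsub⟩ := H n
  have hB2 : 2 ≤ n + 2 := by omega
  have hD1 : 1 ≤ Nat.sqrt (d n) + 1 := Nat.succ_pos _
  have hu1 : 1 ≤ Nat.sqrt (d n + r n) + 1 := Nat.succ_pos _
  have hδd : d n + r n ≤ 2 * d n := by have := hrd n; omega
  have huD : Nat.sqrt (d n + r n) + 1 ≤ 2 * (Nat.sqrt (d n) + 1) := sqrt_add_one_le hδd
  have hRle : 8 * (d n + r n) / (Nat.sqrt (d n + r n) + 1 + 1) ≤ 16 * (Nat.sqrt (d n) + 1) :=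
    (rounds_le _).trans (by omega)
  -- size of a minimal circuit for `h` (an opaque name `s`, so that no tactic unfolds `complexity`)
  obtain ⟨s, hs⟩ : ∃ s : ℕ, complexity h = s := ⟨_, rfl⟩
  have hsle : s ≤ (n + 2) ^ e₂ :=
    calc s = complexity h := hs.symm
      _ ≤ complexity (perPoly (Fin (q n)) ℚ) := IsProjection.complexity_le_holds hproj
      _ = complexity ((perPoly (Fin (q n)) ℤ).map (Int.castRingHom ℚ)) := by rw [map_perPoly]
      _ ≤ constantFreeComplexity (perPoly (Fin (q n)) ℤ) :=
          complexity_map_le_constantFreeComplexity _ _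
      _ ≤ (n + 2) ^ e₂ := he₂ n
  -- the exponent
  obtain ⟨hδ1, hsE, hu1', hδu⟩ := prop321_exponent hB2 (he₁ n) (hrd n) hsle
  -- the sparsity bound of a polynomial of degree `≤ u` in `δ` variables under the substitution (3.1)
  have hsparse : ∀ p : MvPolynomial (Fin (d n) ⊕ Fin (r n)) ℚ, p.totalDegree ≤ Nat.sqrt (d n + r n) + 1 →
      (MvPolynomial.aeval (kpSubst (d n) (r n)) p).support.card ≤
        (n + 2) ^ (prop321Const (e₁ + e₂ + 6) * (Nat.sqrt (d n) + 1)) := by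
    intro p hp
    calc (MvPolynomial.aeval (kpSubst (d n) (r n)) p).support.card ≤ p.support.card :=
          card_support_aeval_le_of_isTerm (isTerm_kpSubst _ _) p
      _ ≤ (Nat.sqrt (d n + r n) + 1 + 1) *
            (Fintype.card (Fin (d n) ⊕ Fin (r n)) + (Nat.sqrt (d n + r n) + 1)) ^ (Nat.sqrt (d n + r n) + 1) :=
          DepthReduction.card_le_of_degree_le _ hu1 fun m hm => (le_totalDegree hm).trans hp
      _ = (Nat.sqrt (d n + r n) + 1 + 1) *
            (d n + r n + (Nat.sqrt (d n + r n) + 1)) ^ (Nat.sqrt (d n + r n) + 1) := by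
          rw [Fintype.card_sum, Fintype.card_fin, Fintype.card_fin]
      _ ≤ (n + 2) ^ (prop321Const (e₁ + e₂ + 6) * (Nat.sqrt (d n) + 1)) := prop321_tBound hB2 hD1 hu1' hδu huD
  have hfmap : (f n).map (Int.castRingHom ℚ) = MvPolynomial.aeval (kpSubst (d n) (r n)) h := hsub.symm
  -- a minimal circuit for `h` and its straight-line program
  obtain ⟨P, hP1, hP2, hP3⟩ := exists_computes_size_eq_complexity h
  obtain ⟨S, hSlen, hcases⟩ := DepthReduction.exists_slp P hP1
  rw [show P.eval = h from hP2] at hcases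
  rw [hs] at hP3
  rcases hcases with ⟨i, hi, hval⟩ | htriv
  · -- main case: `h` is a value of the straight-line program
    have hdegh : (S.val i).totalDegree ≤ d n + r n := by
      rw [← hval]
      have := totalDegree_le_card_of_multilinear hml
      rwa [Fintype.card_sum, Fintype.card_fin, Fintype.card_fin] at this
    obtain ⟨L, hLsum, hLlen, hLT⟩ := S.exists_sum_prod (d n + r n) (t := Nat.sqrt (d n + r n) + 1) hu1 hi hdegh
    rw [hSlen, hP3] at hLlen
    refine ⟨L.length, 1 + 4 * (8 * (d n + r n) / (Nat.sqrt (d n + r n) + 1 + 1)),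
      (n + 2) ^ (prop321Const (e₁ + e₂ + 6) * (Nat.sqrt (d n) + 1)),
      fun i j => MvPolynomial.aeval (kpSubst (d n) (r n)) ((L[i.val]).getD j.val 1),
      hLlen.trans (prop321_kBound hB2 hD1 hδ1 hsE hRle), prop321_mBound hD1 hRle, le_rfl, ?_, ?_⟩
    · -- sparsity of the factors
      intro i j
      apply hsparse
      rcases DepthReduction.getD_one_mem_or (L[i.val]) j.val with hmem | hone
      · exact (hLT _ (List.getElem_mem _)).2 _ hmem
      · rw [hone, totalDegree_one]; exact Nat.zero_le _
    · -- the identity `∑ ∏ g i j = f_n`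
      rw [hfmap, hval, ← hLsum]
      have hprod : ∀ i : Fin L.length,
          ∏ j : Fin (1 + 4 * (8 * (d n + r n) / (Nat.sqrt (d n + r n) + 1 + 1))),
              MvPolynomial.aeval (kpSubst (d n) (r n)) ((L[i.val]).getD j.val 1) =
            MvPolynomial.aeval (kpSubst (d n) (r n)) (L[i.val]).prod := fun i => by
        rw [← map_prod, DepthReduction.prod_getD_one _ _ (hLT _ (List.getElem_mem _)).1]
      simp only [hprod]
      rw [map_list_sum, List.map_map]
      exact Fin.sum_univ_fun_getElem L (fun l => MvPolynomial.aeval (kpSubst (d n) (r n)) l.prod)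
  · -- degenerate case: `h` is a variable or a constant, a single term
    have hterm : IsTerm (MvPolynomial.aeval (kpSubst (d n) (r n)) h) := by
      rcases htriv with ⟨j, hj⟩ | ⟨c, hc⟩
      · rw [hj, MvPolynomial.aeval_X]; exact isTerm_kpSubst _ _ j
      · rw [hc, MvPolynomial.aeval_C, Polynomial.algebraMap_eq]; exact isTerm_C c
    have h1 : 1 ≤ (n + 2) ^ (prop321Const (e₁ + e₂ + 6) * (Nat.sqrt (d n) + 1)) :=
      Nat.one_le_pow _ _ (by omega)
    refine ⟨1, 1, 1, fun _ _ => MvPolynomial.aeval (kpSubst (d n) (r n)) h, h1,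
      one_le_prop321Const_mul hD1, h1, fun _ _ => hterm.card_support_le, ?_⟩
    rw [hfmap]; simp


/-- Sanity check: Prop. 3.21 from Prop. 3.17 is an instance (the tree's theorem, re-derived). [cite: Tavenas2014, Prop. 3.21] -/
example (h317 : Tavenas2014_prop_3_17) : Tavenas2014_prop_3_21 := by
  intro hτ f d r hd hrd hdef hdeg hcoeff
  obtain ⟨q, hq, H⟩ := h317 f d r hd (hd.mono hrd) hdef hdeg hcoeff
  exact exists_sps_of_isProjection_perPoly hτ f d r hd hrd q hq H

/-! ### Corollary 3.37 (named fact) -/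

/-- **Tavenas' Corollary 3.37** (thesis 2014, Cor. 3.37, p. 54: Prop. 3.17 applied to the family
`(V_n)` of Lemme 3.36 with `d = n`, `r = 2n + 1`). Printed statement: there is a polynomial `q`
such that, if `Perm_n` is computed by circuits `C_n`, then `V_n` is computed by a circuit
`D_n(Y_1, …, Y_k)`, `D_n` a projection of `C_{q(n)}`, the `Y_i` powers `X^{2^j}` of `X` and
`k ≤ 3n + 1`, `D_n` computing a polynomial homogeneous in the `Y`. Rendering, exactly as for the
tree's `Tavenas2014_prop_3_17` (of which this is the instance `f = V`): the conclusion is stated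
for the underlying polynomial `h_n` — multilinear, a Valiant projection (`IsProjection`) of
`PER_{q(n)}` over `ℚ` with `q` p-bounded (this is what the printed proof establishes, via
Valiant's criterion and the `VNP`-completeness of the permanent, so that substituting into
`C_{q(n)}` gives the printed `D_n`), and `V_n = h_n(X^{2^j}; 2^{2^i})` (`kpSubst`); the homogeneity
clause is dropped and the ambient variable blocks are `x_0, …, x_{2n+2}`, `z_0, …, z_{2n+2}`
(`d = r = 2n + 3 ≥` the printed `d = n`, `r = 2n + 1`, so as to share the bookkeeping `r ≤ d` of
Prop. 3.21; a polynomial in fewer variables is one in more) — each of these makes the statement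
WEAKER than print. Named fact (D-0014); discharged from BCS Thm. (21.29) in
`TavenasVnWitness.lean`. [cite: Tavenas2014, Cor. 3.37] -/
def Tavenas2014_cor_3_37 : Prop :=
  ∃ q : ℕ → ℕ, IsPBounded q ∧ ∀ n,
    ∃ h : MvPolynomial (Fin (2 * n + 3) ⊕ Fin (2 * n + 3)) ℚ,
      IsProjection h (perPoly (Fin (q n)) ℚ) ∧
      (∀ m ∈ h.support, ∀ x, m x ≤ 1) ∧
      MvPolynomial.aeval (kpSubst (2 * n + 3) (2 * n + 3)) h = (tavenasV n).map (Int.castRingHom ℚ)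

/-! ### Theorem 3.3 from Corollary 3.37 -/

open Polynomial in
/-- **Tavenas' Theorem 3.3 from Corollary 3.37** (the `P`-definable route of thesis §2.2,
pp. 53–54, carried out for the real τ-conjecture): if `h_n` as in Cor. 3.37 exists then the real
τ-conjecture forces `τ(PER_n)` not to be polynomially bounded. Proof: assuming
`τ(PER_n) = n^{O(1)}`, `exists_sps_of_isProjection_perPoly` (with `d = r = 2n + 3`) writes `V_n`
as a sum of `k ≤ n^{O(√n)}` products of `m = O(√n)` polynomials with `t ≤ n^{O(√n)}` monomials
over `ℚ ⊂ ℝ`; the real τ-conjecture gives `2^n - 1 = Z_ℝ(V_n) ≤ (k + m + t + 2)^c = 2^{O(√n log n)}`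
(`le_card_roots_toFinset_map_tavenasV`), false for `n = 4^j` large (`exists_pow_sqrt_lt_two_pow`).
No counting-hierarchy fact and no Boolean complexity class enters. [cite: Tavenas2014, Thm. 3.3 and §2.2] -/
theorem not_isPBounded_constantFreeComplexity_perPoly_of_realTauConjecture_of_cor_3_37
    (h337 : Tavenas2014_cor_3_37) :
    not_isPBounded_constantFreeComplexity_perPoly_of_realTauConjecture := by
  intro hR hτ
  obtain ⟨c, hc⟩ := hR
  obtain ⟨q, hq, H⟩ := h337
  have hdP : IsPBounded (fun n => 2 * n + 3) :=
    (IsPBounded.iff_exists_le_mul_succ_pow _).2 ⟨3, 1, fun n => by rw [pow_one]; omega⟩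
  obtain ⟨C, hC⟩ := exists_sps_of_isProjection_perPoly hτ (fun n => tavenasV n) (fun n => 2 * n + 3)
    (fun n => 2 * n + 3) hdP (fun n => le_rfl) q hq H
  -- the bad `n`
  obtain ⟨n, hn⟩ := exists_pow_sqrt_lt_two_pow (c * (C + 1) + 1)
  obtain ⟨k, m, t, g, hk, hm, ht, hg, hsum⟩ := hC n
  -- pass to `ℝ[X]`
  set G : Fin k → Fin m → Polynomial ℝ := fun i j => (g i j).map (algebraMap ℚ ℝ) with hG
  have hGsum : (∑ i, ∏ j, G i j) = (tavenasV n).map (Int.castRingHom ℝ) := by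
    have h1 : (∑ i, ∏ j, G i j) = (∑ i, ∏ j, g i j).map (algebraMap ℚ ℝ) := by
      simp only [hG, Polynomial.map_sum, Polynomial.map_prod]
    rw [h1, hsum, Polynomial.map_map, RingHom.ext_int ((algebraMap ℚ ℝ).comp (Int.castRingHom ℚ))
      (Int.castRingHom ℝ)]
  have hGt : ∀ i j, (G i j).support.card ≤ t := fun i j => by
    simp only [hG]
    rw [Polynomial.support_map_of_injective _ (algebraMap ℚ ℝ).injective]
    exact hg i j
  have hne : (∑ i, ∏ j, G i j) ≠ 0 := by
    rw [hGsum]; exact map_tavenasV_ne_zero _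
  -- the real τ-conjecture bound against the `2^n - 1` real roots of `V_n`
  have hroots := hc k m t G hGt hne
  rw [hGsum] at hroots
  replace hroots := (le_card_roots_toFinset_map_tavenasV n).trans hroots
  -- `k + m + t + 2 ≤ (n + 2)^{E + 3}` with `E = C (⌊√d⌋ + 1)`
  set s : ℕ := Nat.sqrt (2 * n + 3) with hs
  set E : ℕ := C * (s + 1) with hE
  have hB1 : 1 ≤ (n + 2) ^ E := Nat.one_le_pow _ _ (by omega)
  have hmE : m ≤ (n + 2) ^ E :=
    hm.trans ((Nat.lt_two_pow_self).le.trans (Nat.pow_le_pow_left (by omega) E))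
  have hsumle : k + m + t + 2 ≤ (n + 2) ^ (E + 3) := by
    have h8 : 8 ≤ (n + 2) ^ 3 :=
      calc 8 = 2 ^ 3 := by norm_num
        _ ≤ (n + 2) ^ 3 := Nat.pow_le_pow_left (by omega) 3
    calc k + m + t + 2 ≤ 5 * (n + 2) ^ E := by omega
      _ ≤ (n + 2) ^ 3 * (n + 2) ^ E := Nat.mul_le_mul_right _ (by omega)
      _ = (n + 2) ^ (E + 3) := by rw [← pow_add, Nat.add_comm 3 E]
  have hexp : c * (E + 3) ≤ c * (C + 1) * (s + 4) := by
    have : C * (s + 1) + 3 ≤ (C + 1) * (s + 4) := by nlinarith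
    calc c * (E + 3) = c * (C * (s + 1) + 3) := by rw [hE]
      _ ≤ c * ((C + 1) * (s + 4)) := Nat.mul_le_mul_left c this
      _ = c * (C + 1) * (s + 4) := by ring
  have key : 2 ^ n - 1 ≤ (n + 2) ^ (c * (C + 1) * (s + 4)) :=
    calc 2 ^ n - 1 ≤ (k + m + t + 2) ^ c := hroots
      _ ≤ ((n + 2) ^ (E + 3)) ^ c := Nat.pow_le_pow_left hsumle c
      _ = (n + 2) ^ (c * (E + 3)) := by rw [← pow_mul, mul_comm]
      _ ≤ (n + 2) ^ (c * (C + 1) * (s + 4)) := Nat.pow_le_pow_right (by omega) hexp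
  -- the extra factor `(n + 2)^{s + 4} ≥ 2` in `hn` absorbs the `- 1`
  have hsplit : (n + 2) ^ ((c * (C + 1) + 1) * (s + 4)) =
      (n + 2) ^ (c * (C + 1) * (s + 4)) * (n + 2) ^ (s + 4) := by
    rw [← pow_add]; congr 1; ring
  have h2le : 2 ≤ (n + 2) ^ (s + 4) :=
    calc 2 ≤ n + 2 := by omega
      _ ≤ (n + 2) ^ (s + 4) := Nat.le_self_pow (by omega) _
  have hLY : 2 * (n + 2) ^ (c * (C + 1) * (s + 4)) ≤ (n + 2) ^ ((c * (C + 1) + 1) * (s + 4)) := by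
    rw [hsplit, mul_comm]
    exact Nat.mul_le_mul_left _ h2le
  have h1L : 1 ≤ (n + 2) ^ ((c * (C + 1) + 1) * (s + 4)) := Nat.one_le_pow _ _ (by omega)
  have h1P : 1 ≤ 2 ^ n := Nat.one_le_two_pow
  omega

end Literature.Computability.AlgebraicComplexity
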